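import Summits.FinalStateConjecture.FinalStateConjecture.Theorems.ClusterCompletenessOmegaLimitMultiKerrIsolatedLimitConvergence
import Summits.FinalStateConjecture.FinalStateConjecture.Theorems.ClusterCompletenessOmegaLimitMultiKerrUniformRecurrenceStarHole
import HarnessLib

/-!
# Route ClusterCompleteness · crux `OmegaLimitMultiKerr` — recurrence self-improves to convergence
# when the reference Kerr label is isolated among the identified dark limits

Structure lemma for the crux stmt-FinalStateConjecture-14664 (`ClusterCompleteness.OmegaLimitMultiKerr`,
rank 9), line `Sketch`, lead gen 6, registered stub
`tendsto_starHole_translate_of_kerr_darkLimits_isolated` (closed form).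

The objects of the crux: a smooth hole chart `Ψ` of a spacetime `𝓢` on the horizon-penetrating
STAR background `starBackground Λ c M a (r_a ∘ Λ⁻¹(· − c))` (domain `{r > max M 0}`, invariant
under the Killing translation `e = Λ∂₀`), whose star deviation `dev★ = Ψ^* g − g_{M,a,Λ,c}` is TAME
after the chart time `τ₀`. Suppose the identification step has been run: every `Cᵏ_loc` ω-limit
("dark limit") of the translates `dev★ (· + Tₙ • Λ∂₀)` is, on the star domain, a difference
`g_{M',a',Λ,c} − g_{M,a,Λ,c}` of boosted Kerr–Schild forms with an admissible label
`(M', a') ∈ L` (all rest-frame radii positive on the star domain). Then: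

* `tendsto_starHole_translate_of_kerr_darkLimits_isolated` (registered stub) — if moreover the
  development RECURS to the reference (along some `Tₙ → +∞` the translates themselves tend to `0`
  in `Cᵏ` on every compact: the label `(M, a)` IS a dark limit) and the reference label is
  ISOLATED (on one compact `K` of the star domain every other admissible label's field is `δ`-far
  from the reference's in `Cᵏ(K)`, `δ > 0`), the translates CONVERGE: `‖dev★ (· + t • Λ∂₀)‖_{Cᵏ(K')}
  → 0` as `t → +∞` through the reals, on every compact `K'` of the star domain.

Proof: the abstract LaSalle statement `tendsto_translate_sub_of_omegaLimits_mem_family_of_isolated`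
(Hale 1980, Ch. I §8, Thm. 8.1: the ω-limit set is connected, so an isolated ω-limit is the whole
ω-limit set, and a one-point ω-limit set is the limit) for the family
`F p = g_{p,Λ,c} − g_{M,a,Λ,c}`, `p ∈ L`, reference member `F (M, a) = 0`; the star plumbing
(openness and `Λ∂₀`-invariance of the star domain, smoothness of `dev★`, tameness from the finite
sup norms on the truncated late regions) is that of `exists_uniformlyRecurrent_starHole_omegaLimit`.
Everything is proved; Mathlib + landed `Theorems` files only; no definitions.

## References
* J. K. Hale, *Ordinary Differential Equations*, 2nd ed., Krieger 1980, Ch. I §8, Thm. 8.1. [Hale1980]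
-/

-- every `Summit.FinalStateConjecture.FinalStateConjecture.…` name repeats the summit = sub-problem segment (D-0017 layout)
set_option linter.dupNamespace false

noncomputable section

open Set Filter Topology Function
open scoped Manifold ContDiff Topology ENNReal

namespace Summit.FinalStateConjecture.FinalStateConjecture.Theorems.ClusterCompleteness

open Literature.Geometry.Lorentzian

/-- **Registered structure stub (crux stmt-FinalStateConjecture-14664, line `Sketch`, stub
`RecurrenceSelfImproves`): recurrence + identification + isolated reference label ⇒ convergence in
the era gauge.** Let `Ψ` be a smooth chart of the spacetime `𝓢` on the star background
`starBackground Λ c M a (x ↦ r_a(Λ⁻¹(x − c)))` whose star deviation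
`dev★ = 𝓢.deviationExtend (starBackground …) Ψ` is TAME (finite `C^{k+1}` sup norms on the star
truncated late regions `{t* > τ₀, r ≤ R}`), and let `L ∋ (M, a)` be a set of labels all of whose
rest-frame radii `r_{a'}(Λ⁻¹(x − c))` are positive on the star domain. Assume (COVER) every
`Cᵏ_loc` ω-limit `g` of the translates `dev★ (· + Tₙ • Λ∂₀)`, `Tₙ → +∞`, agrees on the star domain
with `g_{M',a',Λ,c} − g_{M,a,Λ,c}` for some `(M', a') ∈ L`; (RECURRENCE) along some `Tₙ → +∞` the
translates tend to `0` in `Cᵏ` on every compact of the star domain; (ISOLATION) for some compact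
`K` of the star domain and `δ > 0`, every `p ∈ L` is `(M, a)` or has
`‖g_{p,Λ,c} − g_{M,a,Λ,c}‖_{Cᵏ(K)} ≥ δ`. Then `‖dev★ (· + t • Λ∂₀)‖_{Cᵏ(K')} → 0` as `t → +∞`
through the reals, for every compact `K'` of the star domain. Instance of
`tendsto_translate_sub_of_omegaLimits_mem_family_of_isolated` with the family
`F p = g_{p,Λ,c} − g_{M,a,Λ,c}` (each `Cᵏ` on the star domain, `contDiffAt_boostedKerrBilin`, the
radii being positive there) and reference member `F (M, a) = 0`; plumbing as in
`exists_uniformlyRecurrent_starHole_omegaLimit`. Hale 1980, Ch. I §8, Thm. 8.1. Closed form.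
[cite: Hale1980, Ch. I §8 Thm. 8.1] -/
theorem tendsto_starHole_translate_of_kerr_darkLimits_isolated :
    ∀ (𝓢 : Spacetime 4) (Λ : lorentzGroup) (c : E4) (M a : ℝ)
      {Ψ : (starBackground Λ c M a fun x ↦ Kerr.radius a (poincareInv Λ c x)).domain → 𝓢.carrier},
      ContMDiff 𝓘(ℝ, E4) (𝓡 4) ∞ Ψ → ∀ {k : ℕ} {τ₀ : ℝ},
      (∀ R : ℝ, supCkENorm (Subtype.val ''
          (starBackground Λ c M a fun x ↦ Kerr.radius a (poincareInv Λ c x)).truncLateRegion τ₀ R)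
        (k + 1) (𝓢.deviationExtend
          (starBackground Λ c M a fun x ↦ Kerr.radius a (poincareInv Λ c x)) Ψ) ≠ ⊤) →
      ∀ (L : Set (ℝ × ℝ)), (M, a) ∈ L →
      (∀ p ∈ L, ∀ x ∈ ((starBackground Λ c M a fun x ↦ Kerr.radius a (poincareInv Λ c x)).domain :
        Set E4), 0 < Kerr.radius p.2 (poincareInv Λ c x)) →
      (∀ (g : E4 → E4 →L[ℝ] E4 →L[ℝ] ℝ) (T : ℕ → ℝ),
        ContDiffOn ℝ k g
          ((starBackground Λ c M a fun x ↦ Kerr.radius a (poincareInv Λ c x)).domain : Set E4) →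
        Tendsto T atTop atTop →
        (∀ K ⊆ ((starBackground Λ c M a fun x ↦ Kerr.radius a (poincareInv Λ c x)).domain : Set E4),
          IsCompact K →
          Tendsto (fun n ↦ supCkENorm K k (fun x ↦
            𝓢.deviationExtend (starBackground Λ c M a fun x ↦ Kerr.radius a (poincareInv Λ c x)) Ψ
              (x + T n • (Λ : E4 ≃L[ℝ] E4) (EuclideanSpace.single (0 : Fin 4) (1 : ℝ))) - g x))
            atTop (𝓝 0)) →
        ∃ p ∈ L, ∀ x ∈ ((starBackground Λ c M a fun x ↦ Kerr.radius a (poincareInv Λ c x)).domain :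
          Set E4), g x = boostedKerrBilin Λ c p.1 p.2 x - boostedKerrBilin Λ c M a x) →
      (∃ T : ℕ → ℝ, Tendsto T atTop atTop ∧
        ∀ K ⊆ ((starBackground Λ c M a fun x ↦ Kerr.radius a (poincareInv Λ c x)).domain : Set E4),
          IsCompact K →
          Tendsto (fun n ↦ supCkENorm K k (fun x ↦
            𝓢.deviationExtend (starBackground Λ c M a fun x ↦ Kerr.radius a (poincareInv Λ c x)) Ψ
              (x + T n • (Λ : E4 ≃L[ℝ] E4) (EuclideanSpace.single (0 : Fin 4) (1 : ℝ)))))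
            atTop (𝓝 0)) →
      (∃ K ⊆ ((starBackground Λ c M a fun x ↦ Kerr.radius a (poincareInv Λ c x)).domain : Set E4),
        IsCompact K ∧ ∃ δ : ℝ, 0 < δ ∧ ∀ p ∈ L, p = (M, a) ∨
          ENNReal.ofReal δ ≤ supCkENorm K k (fun x ↦
            boostedKerrBilin Λ c p.1 p.2 x - boostedKerrBilin Λ c M a x)) →
      ∀ K ⊆ ((starBackground Λ c M a fun x ↦ Kerr.radius a (poincareInv Λ c x)).domain : Set E4),
        IsCompact K →
        Tendsto (fun t : ℝ ↦ supCkENorm K k (fun x ↦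
          𝓢.deviationExtend (starBackground Λ c M a fun x ↦ Kerr.radius a (poincareInv Λ c x)) Ψ
            (x + t • (Λ : E4 ≃L[ℝ] E4) (EuclideanSpace.single (0 : Fin 4) (1 : ℝ))))) atTop (𝓝 0) := by
  intro 𝓢 Λ c M a Ψ hΨ k τ₀ hfin L hMa hrad hcover hrec hiso K hKO hK
  -- the star domain is open and invariant under the Killing translation `e = Λ∂₀`
  have hO : IsOpen ((starBackground Λ c M a fun x ↦ Kerr.radius a (poincareInv Λ c x)).domain :
      Set E4) :=
    (starBackground Λ c M a fun x ↦ Kerr.radius a (poincareInv Λ c x)).domain.isOpen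
  have hOe := add_smul_mem_starBackground_domain Λ c M a fun x ↦ Kerr.radius a (poincareInv Λ c x)
  -- the star deviation is `C^∞`, hence `C^{k+1}`, on the star domain
  have hsm := contDiffOn_deviationExtend_star 𝓢 hΨ
  have hh : ContDiffOn ℝ (k + 1)
      (𝓢.deviationExtend (starBackground Λ c M a fun x ↦ Kerr.radius a (poincareInv Λ c x)) Ψ)
      ((starBackground Λ c M a fun x ↦ Kerr.radius a (poincareInv Λ c x)).domain : Set E4) :=
    hsm.of_le (by exact_mod_cast le_top)
  -- tameness along `e` from the finite sup norms on the star truncated late regions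
  have hb : ∀ R : ℝ, ∃ C : ℝ, ∀ i, i ≤ k + 1 → ∀ x ∈ Subtype.val ''
      (starBackground Λ c M a fun x ↦ Kerr.radius a (poincareInv Λ c x)).truncLateRegion τ₀ R,
        ‖iteratedFDeriv ℝ i (𝓢.deviationExtend
          (starBackground Λ c M a fun x ↦ Kerr.radius a (poincareInv Λ c x)) Ψ) x‖ ≤ C :=
    fun R ↦ ⟨_, fun _ hi _ hx ↦ norm_iteratedFDeriv_le_toReal_supCkENorm hi hx _ (hfin R)⟩
  have htame := tame_translate_of_bounded_truncLateRegion
    (starBackground Λ c M a fun x ↦ Kerr.radius a (poincareInv Λ c x))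
    ((Λ : E4 ≃L[ℝ] E4) (EuclideanSpace.single (0 : Fin 4) (1 : ℝ))) hOe
    (KerrSchildChart.time_add_smul Λ c M a) (KerrSchildChart.radius_add_smul Λ c M a)
    ((PiLp.continuous_apply 2 _ 0).comp (continuous_poincareInv Λ c))
    ((Kerr.continuous_radius a).comp (continuous_poincareInv Λ c)) hb
  -- `v - (w - w) = v` in the fibre `W = E4 →L[ℝ] E4 →L[ℝ] ℝ` (reference member `F (M, a) = 0`)
  have h0 : ∀ v w : E4 →L[ℝ] E4 →L[ℝ] ℝ, v - (w - w) = v := fun v w ↦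
    (congrArg (fun z ↦ v - z) (sub_self w)).trans (sub_zero v)
  obtain ⟨K₀, hK₀O, hK₀, δ, hδ, hiso⟩ := hiso
  -- the abstract LaSalle statement for the family `F p = g_{p,Λ,c} − g_{M,a,Λ,c}`, `p₀ = (M, a)`
  have key : Tendsto (fun t : ℝ ↦ supCkENorm K k (fun x ↦
      𝓢.deviationExtend (starBackground Λ c M a fun x ↦ Kerr.radius a (poincareInv Λ c x)) Ψ
          (x + t • (Λ : E4 ≃L[ℝ] E4) (EuclideanSpace.single (0 : Fin 4) (1 : ℝ))) -
        (boostedKerrBilin Λ c M a x - boostedKerrBilin Λ c M a x))) atTop (𝓝 0) := by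
    refine tendsto_translate_sub_of_omegaLimits_mem_family_of_isolated hO hOe hh htame
      (fun (p : ℝ × ℝ) (x : E4) ↦ boostedKerrBilin Λ c p.1 p.2 x - boostedKerrBilin Λ c M a x)
      L (M, a) hMa ?_ hcover ?_ K₀ hK₀O hK₀ hδ ?_ K hKO hK
    · -- every member of the family is `Cᵏ` on the star domain (radii positive there)
      intro p hp x hx
      have hx' : poincareInv Λ c x ∈ Kerr.region a M := hx
      have hr : 0 < Kerr.radius a (poincareInv Λ c x) := Kerr.radius_pos_of_mem_region hx'
      exact ((contDiffAt_boostedKerrBilin Λ c p.1 p.2 (hrad p hp x hx)).sub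
        (contDiffAt_boostedKerrBilin Λ c M a hr)).contDiffWithinAt
    · -- the reference member `F (M, a) = 0` is an ω-limit: the recurrence hypothesis
      obtain ⟨T, hT, hconv⟩ := hrec
      refine ⟨T, hT, fun K' hK'O hK' ↦ (hconv K' hK'O hK').congr fun n ↦ ?_⟩
      exact congrArg (supCkENorm K' k) (funext fun x ↦ (h0 _ _).symm)
    · -- isolation of the reference member in `Cᵏ(K₀)`
      intro p hp
      rcases hiso p hp with rfl | hfar
      · exact Or.inl fun x _ ↦ rfl
      · exact Or.inr (hfar.trans_eq (congrArg (supCkENorm K₀ k) (funext fun x ↦ (h0 _ _).symm)))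
  -- `F (M, a) = 0`: the conclusion of the abstract statement is the goal
  refine key.congr fun t ↦ ?_
  exact congrArg (supCkENorm K k) (funext fun x ↦ h0 _ _)

end Summit.FinalStateConjecture.FinalStateConjecture.Theorems.ClusterCompleteness

end
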